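import Literature.Claims.NS.Balawi2025
import Literature.Analysis.FluidPDE.TorusABCFlow
import Literature.Analysis.FluidPDE.TorusVorticityTensorTransport
import Literature.Analysis.FluidPDE.TorusNSVectorFieldHolder
import Literature.Analysis.FunctionSpaces.TorusRieszFischerParam
import Mathlib.Analysis.SpecialFunctions.ExpDeriv
import HarnessLib

/-!
# C155 `Balawi2025` — refuter kit (ns-claims-refuter-6 g3, refuter of record; cell `ns-claims`, D-0090)

Skeleton `Literature/Claims/NS/Balawi2025.lean` (typist-5 g6, p527666, sha16 daca805b750ebd88; text of
record = Zenodo 17298965 V5, census pin `census/texts/Balawi2025/`, PDF page = printed page).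

Kernel objects (every `ν > 0`):
* `not_Step74sum_T3_classical ν hν : ¬ Step74sum_T3_classical ν` — the window-summed display of the
  proof of Cor 7.4 p.22 l.65–85 (= the bound of Thm 2.1 p.7; (7.4) p.22 summed over the front-fixed
  windows; its first inequality is Lemma 7.1 (7.1) p.19), `∫₀ᵀ‖ω‖_{L∞} ≤ C ∫₀ᵀ‖∇u‖²_{L²}` with
  `C = C(LP profile, ν)` (Remark 2.2 p.7), ALREADY on the classical members of the printed class;
* `not_Step74sum_T3 ν hν : ¬ Step74sum_T3 ν` — the printed-grain display (every global Leray–Hopf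
  solution), via the skeleton's own `step74sum_T3_classical_of`;
* `not_Step74sum_T3_perT ν hν : ¬ Step74sum_T3_perT ν` — even the `C(ν, T)` reading dies (alongside);
* `not_forall_Step74sum_T3 : ¬ ∀ ν, Step74sum_T3 ν`.

Witness (AMPLITUDE, not the rest state): the exact Beltrami shear `U(t,x) = e^{−4π²νt} A (sin 2πx₂,
cos 2πx₂, 0)` = `e^{−4π²νt} • Torus.abcFlow A 0 0` on the unit torus — a global classical AND global
Leray–Hopf solution of the unforced system from the smooth divergence-free `L²` datum `A(sin 2πx₂,
cos 2πx₂, 0)`, for EVERY amplitude `A`. Its vorticity magnitude is constant in space,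
`‖ω(t,·)‖_{L∞} = 2π e^{−4π²νt}|A|` (degree 1 in `A`), while `‖∇U(t)‖²_{L²} = 4π²A² e^{−8π²νt}` (degree 2).
On the horizon `T = 1`: `∫₀¹‖ω‖_∞ ≥ 2π e^{−4π²ν}|A|` and `∫₀¹‖∇U‖²₂ ≤ 4π²A²`, so the display with a
solution-independent `C` forces `2π e^{−4π²ν} A ≤ 4π² C A²` for all `A > 0`; it fails at
`A = e^{−4π²ν} / (2π(C+1))`.
[cite: Balawi2025, Cor 7.4 proof p.22 l.65–85; Thm 2.1 p.7; (7.4) p.22; Lemma 7.1 (7.1) p.19; Remark 2.2 p.7]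

WHAT THIS IS NOT: not a claim about NS regularity or blow-up; not a claim about any author beyond the
typed locator.
-/

set_option linter.dupNamespace false

noncomputable section

open MeasureTheory Set Filter Function
open scoped ENNReal NNReal Topology RealInnerProductSpace

namespace Summit.NavierStokesRegularity.NavierStokesRegularity.Theorems.Balawi2025

open Literature.Analysis Literature.Analysis.FluidPDE Literature.Analysis.FunctionSpaces
open Literature.Claims.NS.Balawi2025

/-! ### The witness: the Beltrami shear `A (sin 2πx₂, cos 2πx₂, 0)` on the unit torus -/

/-- The shear profile `A(sin 2πx₂, cos 2πx₂, 0)` = `abcFlow A 0 0`. [folklore] -/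
abbrev shear (A : ℝ) : UnitAddTorus (Fin 3) → EuclideanSpace ℝ (Fin 3) := Torus.abcFlow A 0 0

/-- The decay rate of the first Stokes shell, `4π²ν`. [folklore] -/
abbrev rate (ν : ℝ) : ℝ := ν * (2 * Real.pi) ^ 2

/-- The exact solution `U(t) = e^{−4π²νt} · shear A`. [folklore] -/
abbrev U (ν A : ℝ) : ℝ → UnitAddTorus (Fin 3) → EuclideanSpace ℝ (Fin 3) :=
  fun t x => Real.exp (-(ν * (2 * Real.pi) ^ 2) * t) • Torus.abcFlow A 0 0 x

/-- Its Bernoulli pressure. [folklore] -/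
abbrev P (ν A : ℝ) : ℝ → UnitAddTorus (Fin 3) → ℝ :=
  fun t x => (-(Real.exp (-(ν * (2 * Real.pi) ^ 2) * t) ^ 2)) * (‖Torus.abcFlow A 0 0 x‖ ^ 2 / 2)

/-- `(U, P)` is a global classical solution of the unforced system on `𝕋³ × [0, ∞)`. [folklore] -/
theorem isClassical (ν A : ℝ) : Torus.IsClassicalNSSolutionOn (Ici 0) ν 0 (U ν A) (P ν A) :=
  Torus.isClassicalNSSolutionOn_abcFlow ν A 0 0

/-- … hence on every `[0, T)`. [folklore] -/
theorem isClassical_Ico (ν A T : ℝ) : Torus.IsClassicalNSSolutionOn (Ico 0 T) ν 0 (U ν A) (P ν A) :=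
  (isClassical ν A).mono Ico_subset_Ici_self (uniqueDiffOn_Ico 0 T)

/-- … and on every `[0, T]`. [folklore] -/
theorem isClassical_Icc (ν A T : ℝ) (hT : 0 < T) :
    Torus.IsClassicalNSSolutionOn (Icc 0 T) ν 0 (U ν A) (P ν A) :=
  (isClassical ν A).mono Icc_subset_Ici_self (uniqueDiffOn_Icc hT)

/-- `U(0) = shear A`. [folklore] -/
theorem U_zero (ν A : ℝ) : U ν A 0 = shear A := by
  funext x; simp [U]

/-- `U` is a global Leray–Hopf weak solution from `shear A`. [folklore] -/
theorem isGlobalLerayHopf (ν A : ℝ) : Torus.IsGlobalLerayHopf ν 0 (shear A) (U ν A) := by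
  intro T hT
  have h := (isClassical ν A).isLerayHopfOn_of_convex (convex_Ici 0) hT (fun t ht => mem_Ici.2 ht.1)
  rwa [U_zero] at h

/-- The shear has constant speed: `‖shear A x‖ = |A|`. [folklore] -/
theorem norm_shear (A : ℝ) (x : UnitAddTorus (Fin 3)) : ‖shear A x‖ = |A| := by
  obtain ⟨h0, h1, h2⟩ := Torus.abcFlow_apply_fin A 0 0 x
  have hn : ‖shear A x‖ ^ 2 = A ^ 2 := by
    rw [EuclideanSpace.norm_sq_eq, Fin.sum_univ_three]
    simp only [Real.norm_eq_abs, sq_abs]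
    rw [show shear A x 0 = _ from h0, show shear A x 1 = _ from h1, show shear A x 2 = _ from h2]
    have he : (UnitAddTorus.mFourier (Pi.single (2 : Fin 3) (1 : ℤ)) x).re ^ 2 +
        (UnitAddTorus.mFourier (Pi.single (2 : Fin 3) (1 : ℤ)) x).im ^ 2 = 1 := by
      have h := Torus.norm_mFourier_apply (Pi.single (2 : Fin 3) (1 : ℤ)) x
      rw [Complex.norm_eq_sqrt_sq_add_sq, Real.sqrt_eq_one] at h
      exact h
    nlinarith [he]
  have h := Real.sqrt_sq (norm_nonneg (shear A x))
  rw [hn, Real.sqrt_sq_eq_abs] at h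
  exact h.symm

/-- Pointwise speed of the solution: `‖U(t,x)‖ = e^{−4π²νt}|A|`. [folklore] -/
theorem norm_U (ν A t : ℝ) (x : UnitAddTorus (Fin 3)) :
    ‖U ν A t x‖ = Real.exp (-(rate ν) * t) * |A| := by
  simp [U, norm_smul, Real.abs_exp, norm_shear]

/-- `∫‖shear A‖² = A²`. [folklore] -/
theorem integral_norm_sq_shear (A : ℝ) : ∫ x, ‖shear A x‖ ^ 2 = A ^ 2 := by
  have := Torus.integral_norm_sq_abcFlow A 0 0
  simpa using this

/-- `‖∇ shear A‖₂² = 4π² A²`. [folklore] -/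
theorem gradNormSq_shear (A : ℝ) : Torus.gradNormSq (shear A) = 4 * Real.pi ^ 2 * A ^ 2 := by
  have h := Torus.integral_inner_laplacian_self_eq_neg_gradNormSq (Torus.isSmooth_abcFlow A 0 0)
  have h2 : ∫ x, ⟪Torus.laplacian (Torus.abcFlow A 0 0) x, Torus.abcFlow A 0 0 x⟫ =
      -(4 * Real.pi ^ 2) * ∫ x, ‖Torus.abcFlow A 0 0 x‖ ^ 2 := by
    rw [← integral_const_mul]
    refine integral_congr_ae (ae_of_all _ fun x => ?_)
    dsimp only
    rw [Torus.laplacian_abcFlow, inner_neg_left, real_inner_smul_left, real_inner_self_eq_norm_sq]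
    ring
  rw [h2, Torus.integral_norm_sq_abcFlow] at h
  simp only [shear]
  linarith

/-- `‖∇U(t)‖₂² = 4π²A² e^{−8π²νt}`. [folklore] -/
theorem gradNormSq_U (ν A t : ℝ) :
    Torus.gradNormSq (U ν A t) = 4 * Real.pi ^ 2 * A ^ 2 * Real.exp (-(2 * rate ν) * t) := by
  have h : U ν A t = fun x => Real.exp (-(rate ν) * t) • shear A x := rfl
  rw [h, Torus.gradNormSq_fun_const_smul (Torus.isSmooth_abcFlow A 0 0), gradNormSq_shear]
  have he : Real.exp (-(rate ν) * t) ^ 2 = Real.exp (-(2 * rate ν) * t) := by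
    rw [sq, ← Real.exp_add]; ring_nf
  rw [he]; ring

/-- The vorticity tensor of the solution: `W_{i+1,i+2}(U(t))(x) = 2π U(t,x)_i` (Beltrami). [folklore] -/
theorem vorticityTensor_U (ν A t : ℝ) (i : Fin 3) (x : UnitAddTorus (Fin 3)) :
    torusVorticityTensor (U ν A t) (i + 1) (i + 2) x = 2 * Real.pi * U ν A t x i := by
  have h : U ν A t = Real.exp (-(rate ν) * t) • shear A := rfl
  have hd : ∀ j, Torus.partialDeriv j (U ν A t) = Real.exp (-(rate ν) * t) • Torus.partialDeriv j (shear A) :=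
    fun j => by rw [h]; exact Torus.partialDeriv_const_smul ((Torus.isSmooth_abcFlow A 0 0).isContDiff (by simp)) _ j
  have hW : torusVorticityTensor (U ν A t) (i + 1) (i + 2) x =
      Real.exp (-(rate ν) * t) * torusVorticityTensor (shear A) (i + 1) (i + 2) x := by
    simp only [torusVorticityTensor, hd, Pi.smul_apply, PiLp.smul_apply, smul_eq_mul]
    ring
  rw [hW, Torus.torusVorticityTensor_abcFlow A 0 0 i x, h]
  simp only [Pi.smul_apply, PiLp.smul_apply, smul_eq_mul]
  ring

/-- The squared vorticity magnitude of the solution is CONSTANT in space: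
`|ω(t,x)|² = 4π² e^{−8π²νt} A²`. [folklore] -/
theorem vorticitySqAt_U (ν A t : ℝ) (x : UnitAddTorus (Fin 3)) :
    torusVorticitySqAt (U ν A t) x = 4 * Real.pi ^ 2 * (Real.exp (-(rate ν) * t) * |A|) ^ 2 := by
  have hW : ∀ i j, (Torus.partialDeriv i (U ν A t) x) j - (Torus.partialDeriv j (U ν A t) x) i =
      torusVorticityTensor (U ν A t) i j x := fun i j => rfl
  unfold torusVorticitySqAt
  simp only [hW, Fin.sum_univ_three]
  have h01 : torusVorticityTensor (U ν A t) 0 1 x = 2 * Real.pi * U ν A t x 2 := by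
    simpa using vorticityTensor_U ν A t 2 x
  have h12 : torusVorticityTensor (U ν A t) 1 2 x = 2 * Real.pi * U ν A t x 0 := by
    simpa using vorticityTensor_U ν A t 0 x
  have h20 : torusVorticityTensor (U ν A t) 2 0 x = 2 * Real.pi * U ν A t x 1 := by
    simpa using vorticityTensor_U ν A t 1 x
  have h10 := torusVorticityTensor_swap (U ν A t) 0 1 x
  have h21 := torusVorticityTensor_swap (U ν A t) 1 2 x
  have h02 := torusVorticityTensor_swap (U ν A t) 2 0 x
  have h00 : torusVorticityTensor (U ν A t) 0 0 x = 0 := by unfold torusVorticityTensor; ring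
  have h11 : torusVorticityTensor (U ν A t) 1 1 x = 0 := by unfold torusVorticityTensor; ring
  have h22 : torusVorticityTensor (U ν A t) 2 2 x = 0 := by unfold torusVorticityTensor; ring
  rw [h10, h21, h02, h01, h12, h20, h00, h11, h22]
  have hn : ‖U ν A t x‖ ^ 2 = (U ν A t x 0) ^ 2 + (U ν A t x 1) ^ 2 + (U ν A t x 2) ^ 2 := by
    rw [EuclideanSpace.norm_sq_eq, Fin.sum_univ_three]
    simp only [Real.norm_eq_abs, sq_abs]
  rw [norm_U] at hn
  nlinarith [hn]

/-- `√|ω(t,x)|² = 2π e^{−4π²νt}|A|`. [folklore] -/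
theorem sqrt_vorticitySqAt_U (ν A t : ℝ) (x : UnitAddTorus (Fin 3)) :
    Real.sqrt (torusVorticitySqAt (U ν A t) x) = 2 * Real.pi * (Real.exp (-(rate ν) * t) * |A|) := by
  rw [vorticitySqAt_U, show 4 * Real.pi ^ 2 * (Real.exp (-(rate ν) * t) * |A|) ^ 2 =
    (2 * Real.pi * (Real.exp (-(rate ν) * t) * |A|)) ^ 2 by ring]
  exact Real.sqrt_sq (by positivity)


/-! ### The datum at the Leray–Hopf grain -/

/-- The shear datum is square-integrable (continuous on the compact torus). [folklore] -/
theorem memLp_shear (A : ℝ) : MemLp (shear A) 2 volume := by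
  have hc : Continuous (shear A) := (Torus.isSmooth_abcFlow A 0 0).continuous
  obtain ⟨B, hB⟩ := isCompact_univ.exists_bound_of_continuousOn hc.continuousOn
  exact MemLp.of_bound hc.aestronglyMeasurable B (ae_of_all _ fun y => hB y (mem_univ y))

/-- The shear datum is weakly divergence free (smooth and divergence free). [folklore] -/
theorem isWeaklyDivFree_shear (A : ℝ) : Torus.IsWeaklyDivFree (shear A) :=
  Torus.IsDivFree.isWeaklyDivFree Torus.integral_inner_gradient_eq_neg_integral_mul_divergence_holds
    (Torus.isSmooth_abcFlow A 0 0) (Torus.isDivFree_abcFlow A 0 0)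

/-! ### The two sides of the display on the witness -/

/-- `‖ω(t)‖_{L∞}` of the witness, in the skeleton's extended-real vocabulary:
`vortSupT (U(t)) = 2π e^{−4π²νt}|A|`. [folklore] -/
theorem vortSupT_U (ν A t : ℝ) :
    vortSupT (U ν A t) = ENNReal.ofReal (2 * Real.pi * (Real.exp (-(rate ν) * t) * |A|)) := by
  unfold vortSupT
  have h : ∀ x : UnitAddTorus (Fin 3), ENNReal.ofReal (Real.sqrt (torusVorticitySqAt (U ν A t) x)) =
      ENNReal.ofReal (2 * Real.pi * (Real.exp (-(rate ν) * t) * |A|)) := fun x => by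
    rw [sqrt_vorticitySqAt_U]
  simp only [h]
  exact iSup_const

/-- Lower bound of the BKM side on the horizon `T = 1`:
`2π e^{−4π²ν}|A| ≤ ∫₀¹ ‖ω(t)‖_{L∞} dt`. [folklore] -/
theorem bkmT_U_ge {ν : ℝ} (hν : 0 ≤ ν) (A : ℝ) :
    ENNReal.ofReal (2 * Real.pi * (Real.exp (-(rate ν)) * |A|)) ≤ bkmT (U ν A) 0 1 := by
  unfold bkmT
  have hvol : volume (Ioo (0 : ℝ) 1) = 1 := by simp [Real.volume_Ioo]
  have hr : 0 ≤ rate ν := by positivity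
  calc ENNReal.ofReal (2 * Real.pi * (Real.exp (-(rate ν)) * |A|))
      = ∫⁻ _ in Ioo (0 : ℝ) 1, ENNReal.ofReal (2 * Real.pi * (Real.exp (-(rate ν)) * |A|)) := by
        rw [setLIntegral_const, hvol, mul_one]
    _ ≤ ∫⁻ t in Ioo (0 : ℝ) 1, vortSupT (U ν A t) := by
        refine setLIntegral_mono' measurableSet_Ioo fun t ht => ?_
        rw [vortSupT_U]
        refine ENNReal.ofReal_le_ofReal ?_
        have hexp : Real.exp (-(rate ν)) ≤ Real.exp (-(rate ν) * t) := by
          refine Real.exp_le_exp.mpr ?_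
          have := mul_le_of_le_one_right hr ht.2.le
          linarith
        have h2pi : 0 ≤ 2 * Real.pi := by positivity
        exact mul_le_mul_of_nonneg_left (mul_le_mul_of_nonneg_right hexp (abs_nonneg A)) h2pi

/-- Upper bound of the dissipation side on the horizon `T = 1`: `∫₀¹ ‖∇U(t)‖²_{L²} dt ≤ 4π²A²`.
[folklore] -/
theorem dissT_U_le {ν : ℝ} (hν : 0 ≤ ν) (A : ℝ) :
    dissT (U ν A) 0 1 ≤ ENNReal.ofReal (4 * Real.pi ^ 2 * A ^ 2) := by
  unfold dissT
  have hvol : volume (Ioo (0 : ℝ) 1) = 1 := by simp [Real.volume_Ioo]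
  have hr : 0 ≤ rate ν := by positivity
  calc ∫⁻ t in Ioo (0 : ℝ) 1, ENNReal.ofReal (Torus.gradNormSq (U ν A t))
      ≤ ∫⁻ _ in Ioo (0 : ℝ) 1, ENNReal.ofReal (4 * Real.pi ^ 2 * A ^ 2) := by
        refine setLIntegral_mono' measurableSet_Ioo fun t ht => ?_
        rw [gradNormSq_U]
        refine ENNReal.ofReal_le_ofReal ?_
        have hexp : Real.exp (-(2 * rate ν) * t) ≤ 1 := by
          rw [Real.exp_le_one_iff]
          nlinarith [ht.1]
        have h0 : 0 ≤ 4 * Real.pi ^ 2 * A ^ 2 := by positivity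
        calc 4 * Real.pi ^ 2 * A ^ 2 * Real.exp (-(2 * rate ν) * t)
            ≤ 4 * Real.pi ^ 2 * A ^ 2 * 1 := mul_le_mul_of_nonneg_left hexp h0
          _ = 4 * Real.pi ^ 2 * A ^ 2 := mul_one _
    _ = ENNReal.ofReal (4 * Real.pi ^ 2 * A ^ 2) := by rw [setLIntegral_const, hvol, mul_one]

/-- The amplitude arithmetic: no `C ≥ 0` satisfies `2π e^{−r} A ≤ C · 4π² A²` at
`A = e^{−r} / (2π(C+1))`. [folklore] -/
theorem amplitude_absurd {c r A : ℝ} (hc : 0 ≤ c) (hA : A = Real.exp (-r) / (2 * Real.pi * (c + 1)))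
    (h : 2 * Real.pi * (Real.exp (-r) * |A|) ≤ c * (4 * Real.pi ^ 2 * A ^ 2)) : False := by
  have hpi := Real.pi_pos
  have hApos : 0 < A := by rw [hA]; positivity
  have hden : 2 * Real.pi * (c + 1) ≠ 0 := by positivity
  have hE : A * (2 * Real.pi * (c + 1)) = Real.exp (-r) := by rw [hA]; exact div_mul_cancel₀ _ hden
  rw [abs_of_pos hApos, ← hE] at h
  nlinarith [mul_pos (mul_pos hpi hpi) (mul_pos hApos hApos)]

/-! ### The kills -/

/-- On the horizon `T = 1`, NO solution-independent constant `C` bounds the BKM side of the witness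
family by `C ×` its dissipation side. [folklore] -/
theorem no_uniform_constant {ν : ℝ} (hν : 0 < ν) (C : ℝ≥0)
    (h : ∀ A : ℝ, bkmT (U ν A) 0 1 ≤ C * dissT (U ν A) 0 1) : False := by
  obtain ⟨A, hA⟩ : ∃ A : ℝ, A = Real.exp (-(rate ν)) / (2 * Real.pi * ((C : ℝ) + 1)) := ⟨_, rfl⟩
  have h1 : ENNReal.ofReal (2 * Real.pi * (Real.exp (-(rate ν)) * |A|)) ≤
      (C : ℝ≥0∞) * ENNReal.ofReal (4 * Real.pi ^ 2 * A ^ 2) :=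
    (bkmT_U_ge hν.le A).trans ((h A).trans (by gcongr; exact dissT_U_le hν.le A))
  rw [← ENNReal.ofReal_coe_nnreal, ← ENNReal.ofReal_mul (by positivity)] at h1
  have h2 := (ENNReal.ofReal_le_ofReal_iff (by positivity)).1 h1
  exact amplitude_absurd (by positivity) hA h2

/-- **`¬ Step74sum_T3_classical ν` for every `ν > 0`**: the display of the proof of Cor 7.4 p.22
(Thm 2.1 p.7; (7.4) summed) with a profile/ν-only constant ALREADY fails on the classical members of
the printed class — the Beltrami shears `e^{−4π²νt}A(sin 2πx₂, cos 2πx₂, 0)`, amplitude `A ↓ 0`.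
[cite: Balawi2025, Cor 7.4 proof p.22 l.65–85; Thm 2.1 p.7; Remark 2.2 p.7] -/
theorem not_Step74sum_T3_classical (ν : ℝ) (hν : 0 < ν) : ¬ Step74sum_T3_classical ν := by
  intro hS
  obtain ⟨C, hC⟩ := hS hν
  refine no_uniform_constant hν C fun A => ?_
  have h0 : MemLp (U ν A 0) 2 volume := by rw [U_zero]; exact memLp_shear A
  have hd : Torus.IsWeaklyDivFree (U ν A 0) := by rw [U_zero]; exact isWeaklyDivFree_shear A
  have hLH : Torus.IsGlobalLerayHopf ν 0 (U ν A 0) (U ν A) := by rw [U_zero]; exact isGlobalLerayHopf ν A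
  exact hC (U ν A) (P ν A) h0 hd hLH (isClassical ν A) 1 one_pos

/-- **`¬ Step74sum_T3 ν` for every `ν > 0`** — the PRINTED-GRAIN display of the proof of Cor 7.4
p.22 l.65–85 (= Thm 2.1 p.7: `∫₀ᵀ‖ω‖_{L∞} ≤ C(profile, ν) ∫₀ᵀ‖∇u‖²_{L²}` for every global Leray–Hopf
solution and every `T > 0`): it implies its classical restriction (`step74sum_T3_classical_of`, the
skeleton's own logic), which is refuted above. [cite: Balawi2025, Cor 7.4 proof p.22 l.65–85; Thm 2.1 p.7;
(7.4) p.22; Lemma 7.1 (7.1) p.19; Remark 2.2 p.7] -/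
theorem not_Step74sum_T3 (ν : ℝ) (hν : 0 < ν) : ¬ Step74sum_T3 ν :=
  fun h => not_Step74sum_T3_classical ν hν (step74sum_T3_classical_of h)

/-- Hence the `∀ ν` form consumed on the way to `Cor74_T3` fails (at `ν = 1`, say). [folklore] -/
theorem not_forall_Step74sum_T3 : ¬ ∀ ν : ℝ, Step74sum_T3 ν :=
  fun h => not_Step74sum_T3 1 one_pos (h 1)

/-- **Alongside — even the `C(ν, T)` reading dies** (`Step74sum_T3_perT`, not printed): the witness
family lives on the single horizon `T = 1`, so letting the constant depend on `T` does not help.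
[cite: Balawi2025, Cor 7.4 proof p.22; Remark 2.2 p.7] -/
theorem not_Step74sum_T3_perT (ν : ℝ) (hν : 0 < ν) : ¬ Step74sum_T3_perT ν := by
  intro hS
  obtain ⟨C, hC⟩ := hS hν 1 one_pos
  exact no_uniform_constant hν C fun A =>
    hC (shear A) (memLp_shear A) (isWeaklyDivFree_shear A) (U ν A) (isGlobalLerayHopf ν A)

/-! ### FQN guards (type-exact against the tree decls) -/

example (ν : ℝ) (hν : 0 < ν) : ¬ Literature.Claims.NS.Balawi2025.Step74sum_T3 ν :=
  not_Step74sum_T3 ν hν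

example (ν : ℝ) (hν : 0 < ν) : ¬ Literature.Claims.NS.Balawi2025.Step74sum_T3_classical ν :=
  not_Step74sum_T3_classical ν hν

example : ¬ ∀ ν : ℝ, Literature.Claims.NS.Balawi2025.Step74sum_T3 ν := not_forall_Step74sum_T3

end Summit.NavierStokesRegularity.NavierStokesRegularity.Theorems.Balawi2025

end

-- WHAT THIS IS NOT: not a claim about NS regularity or blow-up; not a claim about any author beyond the typed locator.
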